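import Mathlib.Analysis.Complex.Basic
import Mathlib.Analysis.Real.Sqrt
import Mathlib.Algebra.Order.BigOperators.Ring.Finset
import Mathlib.Logic.Equiv.Prod
import HarnessLib

/-!
# Instrument cell `ym-instrument`, crew (b), task (U): the LOOP-FREE TENSOR-NETWORK LEMMA — the value of a closed finite tensor network without self-loops is bounded by the
# product of the Hilbert–Schmidt norms of its local tensors

QUESTIONS.md: Q-B1 ∕ P-B7 (the ALL-J character-multiplicity column); sc-ref's Lemma R″ (a) (R-DOUBLEPRIME.md 1058aa987410813e, REFEREE §6.48 ∕ R7.20 (e): «the first typed object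
should be the loop-free lemma»); planner ym-cruxidea-19354-4's face F1′ `LoopFreeHSBound` (Cruxes/IR/CruxIdea4UColumn.lean).  Cell `run/shared/lean/pub/ym-instrument/`, HUMAN RULING
D-0084 (2), director-ym R138.  HONEST FRAMING (page 1, binding).  WHAT IS CERTIFIED HERE: PURE FINITE-DIMENSIONAL MULTILINEAR ALGEBRA.  A closed tensor network = a finite vertex type
`V`, a finite edge type `E` with endpoint maps `src tgt : E → V`, bond sizes `d : E → ℕ`, and at every vertex `x` a complex tensor `T x` on the index assignments of the edges incident to
`x`; its value `networkValue` sums, over all assignments `σ` of an index in `Fin (d e)` to every edge `e`, the product over the vertices of the local tensors read at `σ`.  ★ THEOREM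
`norm_networkValue_le`: if NO edge is a self-loop (`src e ≠ tgt e`; parallel edges and cycles are allowed) then `‖networkValue‖ ≤ ∏_x ‖T x‖_HS` (`hsNorm` = the `ℓ²` norm of the
tensor's entries).  Proof: induction on the number of edges by VERTEX MERGE along an edge `u–v` — all `u–v` edges are summed inside the merged tensor sitting at `v` (Cauchy–Schwarz:
`‖merged‖_HS ≤ ‖T u‖_HS ‖T v‖_HS`), the other edges at `u` are redirected to `v` (loop-freeness is preserved), `u` keeps the scalar tensor `1`, the value is unchanged.  A self-loop
breaks the statement (`tr (𝟙/√d) = √d`).  USE (paper-level, NOT typed here): with vertices = links of a plaquette complex, edges = plaquette corners and `T_ℓ` = the Haar projector onto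
the invariants, this is the contraction bound `|Φ_J(X)| ≤ ∏_ℓ m_ℓ(J)^{1/2}` of R″ (a) in Hilbert–Schmidt form; the Haar-projector identity and the corner wiring are NOT in this file.
NOT a statement about any gauge theory; NOT summit-bearing.  Grade (T).
-/

noncomputable section

open Finset

namespace Summit.QuantumFields.YangMills.Theorems.Instrument.LoopFreeNetworkBound

universe u v

variable {V : Type u} {E : Type v}

/-! ## §1 Closed tensor networks: incidence, value, Hilbert–Schmidt norm -/

/-- The edges incident to the vertex `x` (as a subtype of `E`). [folklore] -/
abbrev Inc (src tgt : E → V) (x : V) : Type v := {e : E // src e = x ∨ tgt e = x}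

/-- The squared Hilbert–Schmidt (`ℓ²`) norm of a tensor indexed by the assignments `(a : α) → Fin (d a)`. [folklore] -/
def hsNormSq {α : Type*} [Fintype α] [DecidableEq α] {d : α → ℕ} (f : ((a : α) → Fin (d a)) → ℂ) : ℝ :=
  ∑ τ : ((a : α) → Fin (d a)), ‖f τ‖ ^ 2

/-- The Hilbert–Schmidt norm. [folklore] -/
def hsNorm {α : Type*} [Fintype α] [DecidableEq α] {d : α → ℕ} (f : ((a : α) → Fin (d a)) → ℂ) : ℝ := Real.sqrt (hsNormSq f)

/-- `hsNormSq ≥ 0`. [folklore] -/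
theorem hsNormSq_nonneg {α : Type*} [Fintype α] [DecidableEq α] {d : α → ℕ} (f : ((a : α) → Fin (d a)) → ℂ) : 0 ≤ hsNormSq f :=
  Finset.sum_nonneg fun _ _ => sq_nonneg _

/-- The VALUE of the closed tensor network `(V, E, src, tgt, d, T)`: sum over all edge-index assignments of the product of the local tensors. [folklore] -/
def networkValue [Fintype V] [Fintype E] [DecidableEq E] (src tgt : E → V) (d : E → ℕ)
    (T : (x : V) → (((e : Inc src tgt x) → Fin (d e.1)) → ℂ)) : ℂ :=
  ∑ σ : ((e : E) → Fin (d e)), ∏ x : V, T x (fun e => σ e.1)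

/-! ## §2 Two generic inequalities -/

/-- Summing a nonnegative function over the image of an injective map gives at most the full sum. [folklore] -/
theorem sum_comp_le_of_injective {α β : Type*} [Fintype α] [Fintype β] [DecidableEq β] (φ : α → β) (hφ : Function.Injective φ)
    (g : β → ℝ) (hg : ∀ b, 0 ≤ g b) : ∑ a, g (φ a) ≤ ∑ b, g b := by
  classical
  rw [← Finset.sum_image (f := g) (s := Finset.univ) (g := φ) (fun a _ b _ h => hφ h)]
  exact Finset.sum_le_sum_of_subset_of_nonneg (Finset.subset_univ _) fun b _ _ => hg b

/-- Cauchy–Schwarz for a contraction: `Σ_{p,q} ‖Σ_k F k p · G k q‖² ≤ (Σ_{k,p} ‖F k p‖²) · (Σ_{k,q} ‖G k q‖²)` (the Frobenius norm is submultiplicative). [folklore] -/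
theorem cauchySchwarz_contract {K P Q : Type*} [Fintype K] [Fintype P] [Fintype Q] (F : K → P → ℂ) (G : K → Q → ℂ) :
    ∑ pq : P × Q, ‖∑ k, F k pq.1 * G k pq.2‖ ^ 2 ≤ (∑ kp : K × P, ‖F kp.1 kp.2‖ ^ 2) * (∑ kq : K × Q, ‖G kq.1 kq.2‖ ^ 2) := by
  have step : ∀ pq : P × Q, ‖∑ k, F k pq.1 * G k pq.2‖ ^ 2 ≤ (∑ k, ‖F k pq.1‖ ^ 2) * (∑ k, ‖G k pq.2‖ ^ 2) := by
    intro pq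
    have h1 : ‖∑ k, F k pq.1 * G k pq.2‖ ≤ ∑ k, ‖F k pq.1‖ * ‖G k pq.2‖ :=
      (norm_sum_le _ _).trans (le_of_eq (Finset.sum_congr rfl fun k _ => norm_mul _ _))
    calc ‖∑ k, F k pq.1 * G k pq.2‖ ^ 2 ≤ (∑ k, ‖F k pq.1‖ * ‖G k pq.2‖) ^ 2 := by gcongr
      _ ≤ (∑ k, ‖F k pq.1‖ ^ 2) * (∑ k, ‖G k pq.2‖ ^ 2) := Finset.sum_mul_sq_le_sq_mul_sq _ _ _
  calc ∑ pq : P × Q, ‖∑ k, F k pq.1 * G k pq.2‖ ^ 2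
      ≤ ∑ pq : P × Q, (∑ k, ‖F k pq.1‖ ^ 2) * (∑ k, ‖G k pq.2‖ ^ 2) := Finset.sum_le_sum fun pq _ => step pq
    _ = (∑ p, ∑ k, ‖F k p‖ ^ 2) * (∑ q, ∑ k, ‖G k q‖ ^ 2) := by rw [Fintype.sum_prod_type, Finset.sum_mul_sum]
    _ = (∑ kp : K × P, ‖F kp.1 kp.2‖ ^ 2) * (∑ kq : K × Q, ‖G kq.1 kq.2‖ ^ 2) := by
        rw [Fintype.sum_prod_type, Fintype.sum_prod_type, Finset.sum_comm (f := fun p k => ‖F k p‖ ^ 2),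
          Finset.sum_comm (f := fun q k => ‖G k q‖ ^ 2)]

/-! ## §3 The vertex merge along `u–v` -/

section Merge

variable (src tgt : E → V) (u v : V)

/-- The edges running between `u` and `v` (in either orientation). [folklore] -/
abbrev Btw (e : E) : Prop := (src e = u ∧ tgt e = v) ∨ (src e = v ∧ tgt e = u)

/-- The remaining edges after the merge. [folklore] -/
abbrev ERest : Type v := {e : E // ¬ Btw src tgt u v e}

/-- The contracted edges. [folklore] -/
abbrev EBtw : Type v := {e : E // Btw src tgt u v e}

variable {src tgt u v}

/-- A `u–v` edge is incident to `u`. [folklore] -/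
theorem inc_u_of_btw {e : E} (h : Btw src tgt u v e) : src e = u ∨ tgt e = u := by
  rcases h with ⟨h1, _⟩ | ⟨_, h2⟩; exacts [Or.inl h1, Or.inr h2]

/-- A `u–v` edge is incident to `v`. [folklore] -/
theorem inc_v_of_btw {e : E} (h : Btw src tgt u v e) : src e = v ∨ tgt e = v := by
  rcases h with ⟨_, h2⟩ | ⟨h1, _⟩; exacts [Or.inr h2, Or.inl h1]

/-- An edge with an endpoint `x ∉ {u, v}` is not a `u–v` edge. [folklore] -/
theorem not_btw_of_inc {x : V} (hxu : x ≠ u) (hxv : x ≠ v) {e : E} (h : src e = x ∨ tgt e = x) : ¬ Btw src tgt u v e := by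
  rintro (⟨h1, h2⟩ | ⟨h1, h2⟩) <;> rcases h with h | h
  exacts [hxu (h.symm.trans h1), hxv (h.symm.trans h2), hxv (h.symm.trans h1), hxu (h.symm.trans h2)]

variable (src tgt u v) [DecidableEq V]

/-- New source map: `u` is renamed `v`. [folklore] -/
def srcM (e : ERest src tgt u v) : V := if src e.1 = u then v else src e.1

/-- New target map: `u` is renamed `v`. [folklore] -/
def tgtM (e : ERest src tgt u v) : V := if tgt e.1 = u then v else tgt e.1

variable {src tgt u v}

/-- After the merge no edge is incident to `u` (`u ≠ v`). [folklore] -/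
theorem not_incM_u (huv : u ≠ v) (e : ERest src tgt u v) : ¬ (srcM src tgt u v e = u ∨ tgtM src tgt u v e = u) := by
  rintro (h | h)
  · unfold srcM at h
    split_ifs at h with h1; exacts [huv h.symm, h1 h]
  · unfold tgtM at h
    split_ifs at h with h1; exacts [huv h.symm, h1 h]

/-- Incidence to `v` after the merge = incidence to `u` or to `v` before. [folklore] -/
theorem incM_v_iff (e : ERest src tgt u v) :
    (srcM src tgt u v e = v ∨ tgtM src tgt u v e = v) ↔ ((src e.1 = u ∨ tgt e.1 = u) ∨ (src e.1 = v ∨ tgt e.1 = v)) := by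
  unfold srcM tgtM
  constructor
  · rintro (h | h)
    · split_ifs at h with h1; exacts [Or.inl (Or.inl h1), Or.inr (Or.inl h)]
    · split_ifs at h with h1; exacts [Or.inl (Or.inr h1), Or.inr (Or.inr h)]
  · rintro ((h | h) | (h | h))
    · left; rw [if_pos h]
    · right; rw [if_pos h]
    · left; by_cases h1 : src e.1 = u
      · rw [if_pos h1]
      · rw [if_neg h1]; exact h
    · right; by_cases h1 : tgt e.1 = u
      · rw [if_pos h1]
      · rw [if_neg h1]; exact h

/-- Incidence to a third vertex is unchanged by the merge. [folklore] -/
theorem incM_iff_of_ne {x : V} (hxu : x ≠ u) (hxv : x ≠ v) (e : ERest src tgt u v) :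
    (srcM src tgt u v e = x ∨ tgtM src tgt u v e = x) ↔ (src e.1 = x ∨ tgt e.1 = x) := by
  unfold srcM tgtM
  constructor
  · rintro (h | h)
    · split_ifs at h with h1; exacts [absurd h.symm hxv, Or.inl h]
    · split_ifs at h with h1; exacts [absurd h.symm hxv, Or.inr h]
  · rintro (h | h)
    · left; rw [if_neg (fun h1 => hxu (h.symm.trans h1))]; exact h
    · right; rw [if_neg (fun h1 => hxu (h.symm.trans h1))]; exact h

/-- Loop-freeness is preserved by the merge (`u ≠ v`). [folklore] -/
theorem loopFree_merge (hloop : ∀ e, src e ≠ tgt e) (e : ERest src tgt u v) : srcM src tgt u v e ≠ tgtM src tgt u v e := by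
  obtain ⟨e, he⟩ := e
  unfold srcM tgtM
  intro h
  simp only at h
  by_cases h1 : src e = u <;> by_cases h2 : tgt e = u
  · exact hloop e (h1.trans h2.symm)
  · rw [if_pos h1, if_neg h2] at h
    exact he (Or.inl ⟨h1, h.symm⟩)
  · rw [if_neg h1, if_pos h2] at h
    exact he (Or.inr ⟨h, h2⟩)
  · rw [if_neg h1, if_neg h2] at h
    exact hloop e h

/-- The merge strictly decreases the number of edges as soon as one `u–v` edge exists. [folklore] -/
theorem card_eRest_lt [Fintype E] [DecidableEq E] {e₀ : E} (h : Btw src tgt u v e₀) : Fintype.card (ERest src tgt u v) < Fintype.card E :=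
  Fintype.card_subtype_lt (p := fun e => ¬ Btw src tgt u v e) (x := e₀) (not_not.2 h)

variable (src tgt u v)

/-- The MERGED local tensors: `u` carries the scalar `1`; `v` carries the contraction over the `u–v` edges of `T u` and `T v`; every other vertex keeps its tensor. [folklore] -/
def mergeT [Fintype E] [DecidableEq E] (d : E → ℕ) (T : (x : V) → (((e : Inc src tgt x) → Fin (d e.1)) → ℂ)) (x : V)
    (τ : (e : Inc (srcM src tgt u v) (tgtM src tgt u v) x) → Fin (d e.1.1)) : ℂ :=
  if hxu : x = u then 1
  else if hxv : x = v then
    ∑ κ : ((e : EBtw src tgt u v) → Fin (d e.1)),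
      T u (fun e => if hb : Btw src tgt u v e.1 then κ ⟨e.1, hb⟩
          else τ ⟨⟨e.1, hb⟩, by rw [hxv]; exact (incM_v_iff ⟨e.1, hb⟩).2 (Or.inl e.2)⟩)
        * T v (fun e => if hb : Btw src tgt u v e.1 then κ ⟨e.1, hb⟩
          else τ ⟨⟨e.1, hb⟩, by rw [hxv]; exact (incM_v_iff ⟨e.1, hb⟩).2 (Or.inr e.2)⟩)
  else T x (fun e => τ ⟨⟨e.1, not_btw_of_inc hxu hxv e.2⟩, (incM_iff_of_ne hxu hxv ⟨e.1, _⟩).2 e.2⟩)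

variable {src tgt u v}

/-- The merged tensor at `u` is the scalar `1`. [folklore] -/
theorem mergeT_u [Fintype E] [DecidableEq E] (d : E → ℕ) (T : (x : V) → (((e : Inc src tgt x) → Fin (d e.1)) → ℂ)) (τ) :
    mergeT src tgt u v d T u τ = 1 := by
  unfold mergeT; rw [dif_pos rfl]

/-- (E1) The merge does not change the value of the network (`u ≠ v`). [folklore] -/
theorem networkValue_merge [Fintype V] [Fintype E] [DecidableEq E] (huv : u ≠ v) (d : E → ℕ) (T : (x : V) → (((e : Inc src tgt x) → Fin (d e.1)) → ℂ)) :
    networkValue src tgt d T = networkValue (srcM src tgt u v) (tgtM src tgt u v) (fun e => d e.1) (mergeT src tgt u v d T) := by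
  classical
  unfold networkValue
  -- split the assignment `σ` into its `u–v` part `κ` and the rest `σ'`
  rw [← (Equiv.piEquivPiSubtypeProd (Btw src tgt u v) (fun e => Fin (d e))).symm.sum_comp, Fintype.sum_prod_type, Finset.sum_comm]
  refine Finset.sum_congr rfl fun σ' _ => ?_
  have hΦ : ∀ (κ : (e : EBtw src tgt u v) → Fin (d e.1)) (e : E),
      (Equiv.piEquivPiSubtypeProd (Btw src tgt u v) (fun e => Fin (d e))).symm (κ, σ') e
        = if h : Btw src tgt u v e then κ ⟨e, h⟩ else σ' ⟨e, h⟩ := fun _ _ => rfl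
  -- peel off the vertices `u` and `v` from both products
  have hv_mem : v ∈ (Finset.univ : Finset V).erase u := Finset.mem_erase.2 ⟨huv.symm, Finset.mem_univ v⟩
  have split : ∀ f : V → ℂ, ∏ x, f x = f u * (f v * ∏ x ∈ ((Finset.univ : Finset V).erase u).erase v, f x) := by
    intro f
    rw [Finset.mul_prod_erase _ _ hv_mem, Finset.mul_prod_erase _ _ (Finset.mem_univ u)]
  rw [split]
  conv_lhs => arg 2; ext κ; rw [split]
  -- the factors at third vertices do not depend on `κ`
  have third : ∀ κ : (e : EBtw src tgt u v) → Fin (d e.1),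
      ∏ x ∈ ((Finset.univ : Finset V).erase u).erase v,
          T x (fun e => (Equiv.piEquivPiSubtypeProd (Btw src tgt u v) (fun e => Fin (d e))).symm (κ, σ') e.1)
        = ∏ x ∈ ((Finset.univ : Finset V).erase u).erase v, mergeT src tgt u v d T x (fun e => σ' e.1) := by
    intro κ
    refine Finset.prod_congr rfl fun x hx => ?_
    have hxv : x ≠ v := (Finset.mem_erase.1 hx).1
    have hxu : x ≠ u := (Finset.mem_erase.1 (Finset.mem_erase.1 hx).2).1
    simp only [mergeT, dif_neg hxu, dif_neg hxv]
    congr 1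
    funext e
    rw [hΦ, dif_neg (not_btw_of_inc hxu hxv e.2)]
  simp_rw [third, ← mul_assoc, ← Finset.sum_mul, mergeT_u, one_mul]
  congr 1
  simp only [mergeT, dif_neg (Ne.symm huv), dif_pos]
  rfl

/-- (E2) The merged tensor at `v` has Hilbert–Schmidt norm at most `‖T u‖_HS · ‖T v‖_HS` (Cauchy–Schwarz), for `u ≠ v`. [folklore] -/
theorem hsNormSq_mergeT_v_le [Fintype E] [DecidableEq E] (huv : u ≠ v) (d : E → ℕ) (T : (x : V) → (((e : Inc src tgt x) → Fin (d e.1)) → ℂ)) :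
    hsNormSq (mergeT src tgt u v d T v) ≤ hsNormSq (T u) * hsNormSq (T v) := by
  classical
  -- index types: `K` = assignments of the contracted edges, `P`/`Q` = assignments of the surviving legs of `u`/`v`
  let K := (e : EBtw src tgt u v) → Fin (d e.1)
  let IU := {e : Inc src tgt u // ¬ Btw src tgt u v e.1}
  let IV := {e : Inc src tgt v // ¬ Btw src tgt u v e.1}
  let P := (e : IU) → Fin (d e.1.1)
  let Q := (e : IV) → Fin (d e.1.1)
  let combU : K → P → ((e : Inc src tgt u) → Fin (d e.1)) := fun κ p e => if hb : Btw src tgt u v e.1 then κ ⟨e.1, hb⟩ else p ⟨e, hb⟩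
  let combV : K → Q → ((e : Inc src tgt v) → Fin (d e.1)) := fun κ q e => if hb : Btw src tgt u v e.1 then κ ⟨e.1, hb⟩ else q ⟨e, hb⟩
  let F : K → P → ℂ := fun κ p => T u (combU κ p)
  let G : K → Q → ℂ := fun κ q => T v (combV κ q)
  -- restriction of a merged-leg assignment to the `u`-legs and the `v`-legs
  let pU : ((e : Inc (srcM src tgt u v) (tgtM src tgt u v) v) → Fin (d e.1.1)) → P :=
    fun τ e => τ ⟨⟨e.1.1, e.2⟩, (incM_v_iff ⟨e.1.1, e.2⟩).2 (Or.inl e.1.2)⟩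
  let qV : ((e : Inc (srcM src tgt u v) (tgtM src tgt u v) v) → Fin (d e.1.1)) → Q :=
    fun τ e => τ ⟨⟨e.1.1, e.2⟩, (incM_v_iff ⟨e.1.1, e.2⟩).2 (Or.inr e.1.2)⟩
  -- step 1: re-index the HS sum of the merged tensor through the injective map `τ ↦ (pU τ, qV τ)`
  have h1 : hsNormSq (mergeT src tgt u v d T v) ≤ ∑ pq : P × Q, ‖∑ k, F k pq.1 * G k pq.2‖ ^ 2 := by
    unfold hsNormSq
    refine sum_comp_le_of_injective (fun τ => (pU τ, qV τ)) ?_ (fun pq : P × Q => ‖∑ k, F k pq.1 * G k pq.2‖ ^ 2) (fun _ => sq_nonneg _) |>.trans_eq' ?_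
    · intro τ₁ τ₂ h
      simp only [Prod.mk.injEq] at h
      funext e
      rcases (incM_v_iff e.1).1 e.2 with hu | hv
      · exact congrFun h.1 ⟨⟨e.1.1, hu⟩, e.1.2⟩
      · exact congrFun h.2 ⟨⟨e.1.1, hv⟩, e.1.2⟩
    · refine Finset.sum_congr rfl fun τ _ => ?_
      show ‖∑ k, F k (pU τ, qV τ).1 * G k (pU τ, qV τ).2‖ ^ 2 = ‖mergeT src tgt u v d T v τ‖ ^ 2
      congr 2
      unfold mergeT
      rw [dif_neg (Ne.symm huv), dif_pos rfl]
  -- step 2: Cauchy–Schwarz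
  have h2 := cauchySchwarz_contract F G
  -- step 3: the `(κ, p) ↦ combU κ p` re-indexing is injective, so the `F`-sum is at most `‖T u‖²_HS`; same for `G`
  have h3 : (∑ kp : K × P, ‖F kp.1 kp.2‖ ^ 2) ≤ hsNormSq (T u) := by
    unfold hsNormSq
    refine sum_comp_le_of_injective (fun kp : K × P => combU kp.1 kp.2) ?_ (fun ρ => ‖T u ρ‖ ^ 2) (fun _ => sq_nonneg _)
    intro ⟨κ₁, p₁⟩ ⟨κ₂, p₂⟩ h
    simp only at h
    have hκ : κ₁ = κ₂ := by
      funext e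
      have := congrFun h ⟨e.1, inc_u_of_btw e.2⟩
      simpa [combU, dif_pos e.2] using this
    have hp : p₁ = p₂ := by
      funext e
      have := congrFun h e.1
      simpa [combU, dif_neg e.2] using this
    rw [hκ, hp]
  have h4 : (∑ kq : K × Q, ‖G kq.1 kq.2‖ ^ 2) ≤ hsNormSq (T v) := by
    unfold hsNormSq
    refine sum_comp_le_of_injective (fun kq : K × Q => combV kq.1 kq.2) ?_ (fun ρ => ‖T v ρ‖ ^ 2) (fun _ => sq_nonneg _)
    intro ⟨κ₁, q₁⟩ ⟨κ₂, q₂⟩ h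
    simp only at h
    have hκ : κ₁ = κ₂ := by
      funext e
      have := congrFun h ⟨e.1, inc_v_of_btw e.2⟩
      simpa [combV, dif_pos e.2] using this
    have hq : q₁ = q₂ := by
      funext e
      have := congrFun h e.1
      simpa [combV, dif_neg e.2] using this
    rw [hκ, hq]
  have hF : 0 ≤ ∑ kp : K × P, ‖F kp.1 kp.2‖ ^ 2 := Finset.sum_nonneg fun _ _ => sq_nonneg _
  calc hsNormSq (mergeT src tgt u v d T v) ≤ ∑ pq : P × Q, ‖∑ k, F k pq.1 * G k pq.2‖ ^ 2 := h1
    _ ≤ (∑ kp : K × P, ‖F kp.1 kp.2‖ ^ 2) * (∑ kq : K × Q, ‖G kq.1 kq.2‖ ^ 2) := h2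
    _ ≤ hsNormSq (T u) * hsNormSq (T v) := mul_le_mul h3 h4 (Finset.sum_nonneg fun _ _ => sq_nonneg _) (hsNormSq_nonneg _)

/-- (E3) At a third vertex the merged tensor has the same Hilbert–Schmidt norm (we only need `≤`). [folklore] -/
theorem hsNormSq_mergeT_le_of_ne [Fintype E] [DecidableEq E] {x : V} (hxu : x ≠ u) (hxv : x ≠ v) (d : E → ℕ)
    (T : (x : V) → (((e : Inc src tgt x) → Fin (d e.1)) → ℂ)) : hsNormSq (mergeT src tgt u v d T x) ≤ hsNormSq (T x) := by
  classical
  let r : ((e : Inc (srcM src tgt u v) (tgtM src tgt u v) x) → Fin (d e.1.1)) → ((e : Inc src tgt x) → Fin (d e.1)) :=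
    fun τ e => τ ⟨⟨e.1, not_btw_of_inc hxu hxv e.2⟩, (incM_iff_of_ne hxu hxv ⟨e.1, _⟩).2 e.2⟩
  unfold hsNormSq
  refine (sum_comp_le_of_injective r ?_ (fun ρ => ‖T x ρ‖ ^ 2) (fun _ => sq_nonneg _)).trans_eq' ?_
  · intro τ₁ τ₂ h
    funext e
    exact congrFun h ⟨e.1.1, (incM_iff_of_ne hxu hxv e.1).1 e.2⟩
  · refine Finset.sum_congr rfl fun τ _ => ?_
    simp only [mergeT, dif_neg hxu, dif_neg hxv, r]

/-- (E4) The merged tensor at `u` is the scalar `1` on the empty leg set: Hilbert–Schmidt norm `1` (`u ≠ v`). [folklore] -/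
theorem hsNormSq_mergeT_u [Fintype E] [DecidableEq E] (huv : u ≠ v) (d : E → ℕ) (T : (x : V) → (((e : Inc src tgt x) → Fin (d e.1)) → ℂ)) :
    hsNormSq (mergeT src tgt u v d T u) = 1 := by
  classical
  haveI : IsEmpty (Inc (srcM src tgt u v) (tgtM src tgt u v) u) := ⟨fun e => not_incM_u huv e.1 e.2⟩
  unfold hsNormSq
  simp only [mergeT_u, norm_one, one_pow, Finset.sum_const, Finset.card_univ]
  rw [Fintype.card_unique]
  simp

end Merge

/-! ## §4 ★ The loop-free network lemma -/

/-- Squared form, by strong induction on the number of edges (vertex merge along any edge). [folklore] -/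
theorem norm_sq_networkValue_le_aux [Fintype V] [DecidableEq V] (n : ℕ) :
    ∀ {E : Type v} [Fintype E] [DecidableEq E], Fintype.card E = n → ∀ (src tgt : E → V), (∀ e, src e ≠ tgt e) →
      ∀ (d : E → ℕ) (T : (x : V) → (((e : Inc src tgt x) → Fin (d e.1)) → ℂ)),
        ‖networkValue src tgt d T‖ ^ 2 ≤ ∏ x, hsNormSq (T x) := by
  induction n using Nat.strong_induction_on with
  | _ n ih =>
  intro E _ _ hcard src tgt hloop d T
  classical
  by_cases hE : IsEmpty E
  · -- no edges: a single (empty) assignment; every local tensor is a scalar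
    have hval : networkValue src tgt d T = ∏ x, T x (fun e => (default : (e : E) → Fin (d e)) e.1) := by
      unfold networkValue
      rw [Fintype.sum_unique]
    rw [hval, Complex.norm_prod, ← Finset.prod_pow]
    refine le_of_eq (Finset.prod_congr rfl fun x _ => ?_)
    haveI : IsEmpty (Inc src tgt x) := ⟨fun e => hE.false e.1⟩
    unfold hsNormSq
    rw [Fintype.sum_unique]
    congr 2
  · -- pick an edge `e₀ = (u, v)` and merge `u` into `v`
    rw [not_isEmpty_iff] at hE
    obtain ⟨e₀⟩ := hE
    set u := src e₀ with hu
    set v := tgt e₀ with hv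
    have huv : u ≠ v := hloop e₀
    have hbtw : Btw src tgt u v e₀ := Or.inl ⟨rfl, rfl⟩
    have hlt : Fintype.card (ERest src tgt u v) < n := hcard ▸ card_eRest_lt hbtw
    have ih' := ih _ hlt rfl (srcM src tgt u v) (tgtM src tgt u v) (loopFree_merge hloop) (fun e => d e.1) (mergeT src tgt u v d T)
    rw [networkValue_merge huv d T]
    refine ih'.trans ?_
    -- compare the two products vertex by vertex: `u ↦ 1`, `v ↦ ≤ ‖T u‖² ‖T v‖²`, others `≤`
    have hv_mem : v ∈ (Finset.univ : Finset V).erase u := Finset.mem_erase.2 ⟨huv.symm, Finset.mem_univ v⟩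
    rw [← Finset.mul_prod_erase _ _ (Finset.mem_univ u), ← Finset.mul_prod_erase _ _ hv_mem,
      ← Finset.mul_prod_erase Finset.univ (fun x => hsNormSq (T x)) (Finset.mem_univ u),
      ← Finset.mul_prod_erase _ (fun x => hsNormSq (T x)) hv_mem, hsNormSq_mergeT_u huv, one_mul, ← mul_assoc]
    refine mul_le_mul (hsNormSq_mergeT_v_le huv d T) ?_ (Finset.prod_nonneg fun _ _ => hsNormSq_nonneg _)
      (mul_nonneg (hsNormSq_nonneg _) (hsNormSq_nonneg _))
    refine Finset.prod_le_prod (fun _ _ => hsNormSq_nonneg _) fun x hx => ?_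
    have hxv : x ≠ v := (Finset.mem_erase.1 hx).1
    have hxu : x ≠ u := (Finset.mem_erase.1 (Finset.mem_erase.1 hx).2).1
    exact hsNormSq_mergeT_le_of_ne hxu hxv d T

/-- ★★ THE LOOP-FREE TENSOR-NETWORK LEMMA (sc-ref R″ (a), R7.20 (e); planner F1′).  For a closed finite tensor network WITHOUT SELF-LOOPS (`src e ≠ tgt e` for every edge;
parallel edges and cycles allowed), `‖networkValue‖ ≤ ∏_x ‖T x‖_HS`. [folklore] -/
theorem norm_networkValue_le [Fintype V] [DecidableEq V] [Fintype E] [DecidableEq E] (src tgt : E → V) (hloop : ∀ e, src e ≠ tgt e)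
    (d : E → ℕ) (T : (x : V) → (((e : Inc src tgt x) → Fin (d e.1)) → ℂ)) :
    ‖networkValue src tgt d T‖ ≤ ∏ x, hsNorm (T x) := by
  have h := norm_sq_networkValue_le_aux (V := V) (Fintype.card E) rfl src tgt hloop d T
  have hprod : ∏ x, hsNorm (T x) = Real.sqrt (∏ x, hsNormSq (T x)) := by
    unfold hsNorm
    rw [Real.sqrt_prod _ fun x _ => hsNormSq_nonneg (T x)]
  rw [hprod]
  exact Real.le_sqrt (norm_nonneg _) (Finset.prod_nonneg fun _ _ => hsNormSq_nonneg _) |>.2 h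

/-- The same with vertex type `Fin N` (the shape of the planner's `LoopFreeHSBound`). [folklore] -/
theorem norm_networkValue_le_fin (N : ℕ) {E : Type v} [Fintype E] [DecidableEq E] (src tgt : E → Fin N) (hloop : ∀ e, src e ≠ tgt e)
    (d : E → ℕ) (T : (x : Fin N) → (((e : Inc src tgt x) → Fin (d e.1)) → ℂ)) :
    ‖networkValue src tgt d T‖ ≤ ∏ x, hsNorm (T x) :=
  norm_networkValue_le src tgt hloop d T

end Summit.QuantumFields.YangMills.Theorems.Instrument.LoopFreeNetworkBound

end
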